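import Mathlib.Analysis.SpecialFunctions.Complex.Log
import Literature.Analysis.FluidPDE.FiniteFourierModeEulerAngle
import Literature.Analysis.FluidPDE.FiniteFourierModeEulerGirard

/-!
# Kishimoto–Yoneda, §4 Lemma 4.6: the rotation angle of a closed chain is the enclosed solid angle

Support file for `FiniteFourierModeEuler` (N. Kishimoto, T. Yoneda, J. Math. Fluid Mech. 24
(2022) 74 = arXiv:2110.08039). Lemma 4.6 states that the composition `𝓡₁` of the elementary
rotations around a polygon `ω₁ ω₂ ⋯ ω_p` on the sphere is the rotation about `ω₁` by `± A(F*)`,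
the area of the spherical polygon, via `2 Σ θ_j = 2π - A(F*)` (Gauss–Bonnet). In the language of
`FiniteFourierModeEulerAngle` the total rotation is the argument of the product of the frame factors,
and we prove:

* `frameFactor_eq_exp`: at a positively oriented vertex the frame factor is
  `|c × a| |a × b| e^{i(π - θ_a)}`, `θ_a` the dihedral angle (`dihedral`);
* `prod_frameFactor_triangle`: for a positively oriented triangle the product of the three frame
  factors is `|a×b|²|b×c|²|c×a|² e^{-iE}` with `E = θ_a + θ_b + θ_c - π` the angular excess, which by
  Girard's theorem (`girard`) is `4π |T ∩ B| / |B|`, the normalised solid angle of the cone;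
* `polyProd_mul_eq_prod_triangle` (fan triangulation): the product of the frame factors around a
  polygon `q₀ q₁ ⋯ q_m` equals, up to a positive real factor, the product over the fan triangles
  `(q₀, q_j, q_{j+1})` of their triangle products (`frameFactor_trans`).

## References

* [KishimotoYoneda2022] N. Kishimoto, T. Yoneda, J. Math. Fluid Mech. 24 (2022) 74 =
  arXiv:2110.08039, §4 Lemma 4.6 and its proof.
-/

noncomputable section

open Matrix Complex Real MeasureTheory

namespace Literature.Analysis.FluidPDE

namespace KY

/-! ### Polar form of the frame factor -/

section Polar

variable {a b c : Fin 3 → ℝ}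

/-- `c² + τ²|a|² = |c × a|²|a × b|²` for `c = (c × a)·(a × b)`, `τ = [c,a,b]` (Lagrange).
[cite: KishimotoYoneda2022, §4 Lemma 4.6 (proof)] -/
theorem frame_lagrange (c a b : Fin 3 → ℝ) :
    ((c ⨯₃ a) ⬝ᵥ (a ⨯₃ b)) ^ 2 + (c ⬝ᵥ (a ⨯₃ b)) ^ 2 * (a ⬝ᵥ a)
      = ((c ⨯₃ a) ⬝ᵥ (c ⨯₃ a)) * ((a ⨯₃ b) ⬝ᵥ (a ⨯₃ b)) := by
  simp only [real_dot_eq, cross_apply, Matrix.cons_val_zero, Matrix.cons_val_one,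
    Matrix.head_cons, Matrix.cons_val_two, Matrix.tail_cons]
  ring

/-- **The frame factor in polar form.** At the vertex `a` of a positively oriented triangle
`(a, b, c)` (`[a,b,c] > 0`), the frame factor from the plane `(c, a)` to the plane `(a, b)` is
`|c × a| |a × b| e^{i(π - θ_a)}` with `θ_a` the dihedral angle along `a`: the elementary rotation
of Lemma 4.6 is by the exterior angle `π - θ_a`. [cite: KishimotoYoneda2022, §4 Lemma 4.6 (proof,
"acts as the rotation by the angle `2θ_j`")] -/
theorem frameFactor_eq_exp (hτ : 0 < a ⬝ᵥ (b ⨯₃ c)) :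
    frameFactor c a b
      = (Real.sqrt (((c ⨯₃ a) ⬝ᵥ (c ⨯₃ a)) * ((a ⨯₃ b) ⬝ᵥ (a ⨯₃ b))) : ℂ)
          * Complex.exp (I * ((π - dihedral c a b : ℝ) : ℂ)) := by
  have hkca : c ⨯₃ a ≠ 0 := cross_bc_ne_zero_of_triple_pos (by rwa [triple_product_cyclic])
  have hkab : a ⨯₃ b ≠ 0 :=
    cross_bc_ne_zero_of_triple_pos (by rw [triple_product_cyclic, triple_product_cyclic]; exact hτ)
  have hk : (c ⨯₃ a) ⨯₃ (a ⨯₃ b) ≠ 0 := cross_normals_ne_zero hτ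
  have hτ' : 0 < c ⬝ᵥ (a ⨯₃ b) := by rw [triple_product_cyclic, triple_product_cyclic]; exact hτ
  have hρ : 0 < a ⬝ᵥ a := real_dot_self_pos (left_ne_zero_of_triple_pos hτ)
  set K₁ := (c ⨯₃ a) ⬝ᵥ (c ⨯₃ a) with hK₁
  set K₂ := (a ⨯₃ b) ⬝ᵥ (a ⨯₃ b) with hK₂
  have hK₁p : 0 < K₁ := real_dot_self_pos hkca
  have hK₂p : 0 < K₂ := real_dot_self_pos hkab
  set θ := dihedral c a b with hθ
  set cc := (c ⨯₃ a) ⬝ᵥ (a ⨯₃ b) with hcc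
  set τ := c ⬝ᵥ (a ⨯₃ b) with hτdef
  -- cosine and sine of the dihedral angle
  have hcos : Real.cos θ = -cc / (Real.sqrt K₁ * Real.sqrt K₂) := by
    rw [hθ]; unfold dihedral
    rw [cos_luneAngle hk, unitVec_dot_unitVec]; ring
  have hS : Real.sqrt K₁ * Real.sqrt K₂ = Real.sqrt (K₁ * K₂) := (Real.sqrt_mul hK₁p.le K₂).symm
  have hSpos : 0 < Real.sqrt (K₁ * K₂) := Real.sqrt_pos.2 (mul_pos hK₁p hK₂p)
  have hsin_pos : 0 < Real.sin θ := by rw [hθ]; exact sin_luneAngle_pos hk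
  have hlag : cc ^ 2 + τ ^ 2 * (a ⬝ᵥ a) = K₁ * K₂ := frame_lagrange c a b
  have hsin : Real.sin θ = τ * Real.sqrt (a ⬝ᵥ a) / Real.sqrt (K₁ * K₂) := by
    have h1 : Real.sin θ ^ 2 = (τ * Real.sqrt (a ⬝ᵥ a) / Real.sqrt (K₁ * K₂)) ^ 2 := by
      rw [Real.sin_sq, hcos, hS, div_pow, div_pow, mul_pow, Real.sq_sqrt hρ.le, neg_sq,
        Real.sq_sqrt (mul_pos hK₁p hK₂p).le]
      field_simp
      linarith [hlag]
    have h2 : 0 < τ * Real.sqrt (a ⬝ᵥ a) / Real.sqrt (K₁ * K₂) :=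
      div_pos (mul_pos hτ' (Real.sqrt_pos.2 hρ)) hSpos
    nlinarith [h1, hsin_pos, h2, sq_nonneg (Real.sin θ - τ * Real.sqrt (a ⬝ᵥ a) / Real.sqrt (K₁ * K₂)),
      sq_nonneg (Real.sin θ + τ * Real.sqrt (a ⬝ᵥ a) / Real.sqrt (K₁ * K₂))]
  -- assemble
  have hre : cc = -(Real.sqrt (K₁ * K₂) * Real.cos θ) := by
    rw [hcos, hS]; field_simp
  have him : τ * Real.sqrt (a ⬝ᵥ a) = Real.sqrt (K₁ * K₂) * Real.sin θ := by
    rw [hsin]; field_simp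
  unfold frameFactor
  rw [← hcc, ← hτdef]
  have hexp : Complex.exp (I * ((π - θ : ℝ) : ℂ)) = ((-Real.cos θ : ℝ) : ℂ) + I * ((Real.sin θ : ℝ) : ℂ) := by
    rw [mul_comm, Complex.exp_mul_I, ← Complex.ofReal_cos, ← Complex.ofReal_sin, Real.cos_pi_sub,
      Real.sin_pi_sub]
    push_cast; ring
  have him' : (τ : ℂ) * (Real.sqrt (a ⬝ᵥ a) : ℂ) = (Real.sqrt (K₁ * K₂) : ℂ) * (Real.sin θ : ℂ) := by
    exact_mod_cast him
  have hre' : (cc : ℂ) = -((Real.sqrt (K₁ * K₂) : ℂ) * (Real.cos θ : ℂ)) := by exact_mod_cast hre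
  rw [hexp, hre']
  push_cast at him' ⊢
  linear_combination I * him'

/-- The angular excess `θ_a + θ_b + θ_c - π` of the trihedral cone `(a, b, c)`.
[cite: KishimotoYoneda2022, §4 Lemma 4.6 ("`A(F*) = Θ(F*) - (p-2)π`")] -/
def excess (a b c : Fin 3 → ℝ) : ℝ := dihedral c a b + dihedral a b c + dihedral b c a - π

/-- **Lemma 4.6 for a triangle, in frame-factor form.** For a positively oriented triangle the
product of the three frame factors (the factor accumulated by transporting around
`a → b → c → a`) is `|c×a|²|a×b|²|b×c|² · e^{-iE}` with `E` the angular excess: the composed rotation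
`𝓡₁` is the rotation by `∓E = ∓A(T*)`. [cite: KishimotoYoneda2022, §4 Lemma 4.6] -/
theorem prod_frameFactor_triangle (hτ : 0 < a ⬝ᵥ (b ⨯₃ c)) :
    frameFactor c a b * frameFactor a b c * frameFactor b c a
      = ((((c ⨯₃ a) ⬝ᵥ (c ⨯₃ a)) * ((a ⨯₃ b) ⬝ᵥ (a ⨯₃ b)) * ((b ⨯₃ c) ⬝ᵥ (b ⨯₃ c)) : ℝ) : ℂ)
          * Complex.exp (-(I * (excess a b c : ℂ))) := by
  have hτb : 0 < b ⬝ᵥ (c ⨯₃ a) := by rwa [triple_product_cyclic]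
  have hτc : 0 < c ⬝ᵥ (a ⨯₃ b) := by rw [triple_product_cyclic, triple_product_cyclic]; exact hτ
  rw [frameFactor_eq_exp hτ, frameFactor_eq_exp hτb, frameFactor_eq_exp hτc]
  set K₁ := (c ⨯₃ a) ⬝ᵥ (c ⨯₃ a)
  set K₂ := (a ⨯₃ b) ⬝ᵥ (a ⨯₃ b)
  set K₃ := (b ⨯₃ c) ⬝ᵥ (b ⨯₃ c)
  have h1 : 0 ≤ K₁ := real_dot_self_nonneg _
  have h2 : 0 ≤ K₂ := real_dot_self_nonneg _
  have h3 : 0 ≤ K₃ := real_dot_self_nonneg _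
  have hsq : (Real.sqrt (K₁ * K₂) : ℂ) * (Real.sqrt (K₂ * K₃) : ℂ) * (Real.sqrt (K₃ * K₁) : ℂ)
      = ((K₁ * K₂ * K₃ : ℝ) : ℂ) := by
    norm_cast
    rw [← Real.sqrt_mul (mul_nonneg h1 h2), ← Real.sqrt_mul (mul_nonneg (mul_nonneg h1 h2) (mul_nonneg h2 h3))]
    rw [show K₁ * K₂ * (K₂ * K₃) * (K₃ * K₁) = (K₁ * K₂ * K₃) * (K₁ * K₂ * K₃) by ring]
    exact Real.sqrt_mul_self (mul_nonneg (mul_nonneg h1 h2) h3)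
  have hexp : Complex.exp (I * ((π - dihedral c a b : ℝ) : ℂ)) * Complex.exp (I * ((π - dihedral a b c : ℝ) : ℂ))
      * Complex.exp (I * ((π - dihedral b c a : ℝ) : ℂ)) = Complex.exp (-(I * (excess a b c : ℂ))) := by
    rw [← Complex.exp_add, ← Complex.exp_add]
    have : I * ((π - dihedral c a b : ℝ) : ℂ) + I * ((π - dihedral a b c : ℝ) : ℂ)
        + I * ((π - dihedral b c a : ℝ) : ℂ) = -(I * (excess a b c : ℂ)) + 2 * π * I := by
      unfold excess; push_cast; ring
    rw [this, Complex.exp_add, Complex.exp_two_pi_mul_I, mul_one]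
  calc _ = ((Real.sqrt (K₁ * K₂) : ℂ) * (Real.sqrt (K₂ * K₃) : ℂ) * (Real.sqrt (K₃ * K₁) : ℂ))
        * (Complex.exp (I * ((π - dihedral c a b : ℝ) : ℂ)) * Complex.exp (I * ((π - dihedral a b c : ℝ) : ℂ))
          * Complex.exp (I * ((π - dihedral b c a : ℝ) : ℂ))) := by ring
    _ = _ := by rw [hsq, hexp]

/-- **Girard's theorem** for the excess: `E = 4π |T ∩ B| / |B|` whenever the ball has positive
radius. [folklore] -/
theorem excess_eq (hτ : 0 < a ⬝ᵥ (b ⨯₃ c)) {R : ℝ} (hR : (volume (ball₃ R)).toReal ≠ 0) :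
    excess a b c = 4 * π * (volume (triCone a b c ∩ ball₃ R)).toReal / (volume (ball₃ R)).toReal := by
  have h := girard hτ R
  unfold excess
  field_simp
  linarith [h]

end Polar

/-! ### Fan triangulation of a polygon -/

section Fan

variable {q : ℕ → Fin 3 → ℝ}

/-- The product of the frame factors around the closed polygon `q₀ q₁ ⋯ q_m` (vertices
`q₁, …, q_{m-1}` between their neighbours, then `q_m` between `q_{m-1}` and `q₀`, then `q₀`
between `q_m` and `q₁`); this is the product appearing in
`dot_self_eq_zero_or_conj_prod_frameFactor_eq` for the `(m+1)`-periodic chain.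
[cite: KishimotoYoneda2022, §4 Lemma 4.6] -/
def polyProd (q : ℕ → Fin 3 → ℝ) (m : ℕ) : ℂ :=
  (∏ j ∈ Finset.Ico 1 m, frameFactor (q (j - 1)) (q j) (q (j + 1)))
    * frameFactor (q (m - 1)) (q m) (q 0) * frameFactor (q m) (q 0) (q 1)

/-- The product of the three frame factors of the fan triangle `(q₀, q_j, q_{j+1})` traversed
`q₀ → q_j → q_{j+1} → q₀`. [cite: KishimotoYoneda2022, §4 Lemma 4.6] -/
def triProd (q : ℕ → Fin 3 → ℝ) (j : ℕ) : ℂ :=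
  frameFactor (q (j + 1)) (q 0) (q j) * frameFactor (q 0) (q j) (q (j + 1))
    * frameFactor (q j) (q (j + 1)) (q 0)

/-- `|a × b|² = |b × a|²`. [folklore] -/
theorem cross_self_dot_comm (a b : Fin 3 → ℝ) : (a ⨯₃ b) ⬝ᵥ (a ⨯₃ b) = (b ⨯₃ a) ⬝ᵥ (b ⨯₃ a) := by
  rw [← cross_anticomm b a, neg_dotProduct, dotProduct_neg, neg_neg]

/-- Gluing one more fan triangle: `Poly(m) · W(T_m) = |q₀ × q_m|⁴ · Poly(m+1)`.
[cite: KishimotoYoneda2022, §4 Lemma 4.6 (proof)] -/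
theorem polyProd_mul_triProd {m : ℕ} (hm : 2 ≤ m) :
    polyProd q m * triProd q m
      = ((((q 0 ⨯₃ q m) ⬝ᵥ (q 0 ⨯₃ q m)) : ℝ) : ℂ) ^ 2 * polyProd q (m + 1) := by
  unfold polyProd triProd
  obtain ⟨k, rfl⟩ : ∃ k, m = k + 1 := ⟨m - 1, by omega⟩
  rw [show k + 1 + 1 = k + 2 from rfl, show k + 2 - 1 = k + 1 from rfl, show k + 1 - 1 = k from rfl]
  rw [Finset.prod_Ico_succ_top (by omega : 1 ≤ k + 1)]
  rw [show k + 1 - 1 = k from rfl, show k + 1 + 1 = k + 2 from rfl]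
  have hX := frameFactor_trans (q k) (q (k + 1)) (q 0) (q (k + 2))
  have hY := frameFactor_trans (q (k + 2)) (q 0) (q (k + 1)) (q 1)
  rw [cross_self_dot_comm (q (k + 1)) (q 0)] at hX
  set A := ∏ j ∈ Finset.Ico 1 (k + 1), frameFactor (q (j - 1)) (q j) (q (j + 1))
  set K := ((((q 0 ⨯₃ q (k + 1)) ⬝ᵥ (q 0 ⨯₃ q (k + 1))) : ℝ) : ℂ)
  linear_combination
    (A * frameFactor (q (k + 1)) (q (k + 2)) (q 0)
      * (frameFactor (q (k + 2)) (q 0) (q (k + 1)) * frameFactor (q (k + 1)) (q 0) (q 1))) * hX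
    + (A * frameFactor (q (k + 1)) (q (k + 2)) (q 0) * (-K * frameFactor (q k) (q (k + 1)) (q (k + 2)))) * hY

/-- **Fan triangulation (Lemma 4.6 reduced to triangles).** The frame-factor product around the
polygon `q₀ q₁ ⋯ q_m`, times a positive real number, is the product of the triangle products of the
fan triangles `(q₀, q_j, q_{j+1})`, `1 ≤ j < m`: the composed rotation of the polygon is the
composition of those of the fan triangles. [cite: KishimotoYoneda2022, §4 Lemma 4.6 (proof)] -/
theorem polyProd_mul_eq_prod_triProd {m : ℕ} (hm : 2 ≤ m) :
    polyProd q m * ∏ j ∈ Finset.Ico 2 m, ((((q 0 ⨯₃ q j) ⬝ᵥ (q 0 ⨯₃ q j)) : ℝ) : ℂ) ^ 2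
      = ∏ j ∈ Finset.Ico 1 m, triProd q j := by
  induction m, hm using Nat.le_induction with
  | base =>
    simp only [Finset.Ico_self, Finset.prod_empty, mul_one]
    rw [show Finset.Ico 1 2 = {1} from rfl, Finset.prod_singleton]
    unfold polyProd triProd
    rw [show Finset.Ico 1 2 = {1} from rfl, Finset.prod_singleton]
    ring
  | succ m hm ih =>
    rw [Finset.prod_Ico_succ_top (by omega : 2 ≤ m), Finset.prod_Ico_succ_top (by omega : 1 ≤ m),
      ← ih]
    have h := polyProd_mul_triProd (q := q) hm
    linear_combination (-(∏ j ∈ Finset.Ico 2 m, ((((q 0 ⨯₃ q j) ⬝ᵥ (q 0 ⨯₃ q j)) : ℝ) : ℂ) ^ 2)) * h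

/-- **Lemma 4.6 (the rotation angle of a polygon is its solid angle), algebraic form.** If all fan
triangles `(q₀, q_j, q_{j+1})`, `1 ≤ j < m`, are positively oriented, the frame-factor product of
the polygon is a positive multiple of `e^{-iS}`, `S = Σ_j E(q₀, q_j, q_{j+1})` the total excess of the
fan; in particular, if the product is real then `sin S = 0`, i.e. the rotation angle lies in `πℤ`.
[cite: KishimotoYoneda2022, §4 Lemma 4.6] -/
theorem sin_sum_excess_eq_zero {m : ℕ} (hm : 2 ≤ m)
    (hτ : ∀ j, 1 ≤ j → j < m → 0 < q 0 ⬝ᵥ (q j ⨯₃ q (j + 1)))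
    (hreal : (starRingEnd ℂ) (polyProd q m) = polyProd q m) :
    Real.sin (∑ j ∈ Finset.Ico 1 m, excess (q 0) (q j) (q (j + 1))) = 0 := by
  -- each triangle product is a positive multiple of `e^{-iE_j}`
  have htri : ∀ j ∈ Finset.Ico 1 m, triProd q j
      = ((((q (j + 1) ⨯₃ q 0) ⬝ᵥ (q (j + 1) ⨯₃ q 0)) * ((q 0 ⨯₃ q j) ⬝ᵥ (q 0 ⨯₃ q j))
          * ((q j ⨯₃ q (j + 1)) ⬝ᵥ (q j ⨯₃ q (j + 1))) : ℝ) : ℂ)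
          * Complex.exp (-(I * (excess (q 0) (q j) (q (j + 1)) : ℂ))) := by
    intro j hj
    rw [Finset.mem_Ico] at hj
    exact prod_frameFactor_triangle (hτ j hj.1 hj.2)
  have hfan := polyProd_mul_eq_prod_triProd (q := q) hm
  rw [Finset.prod_congr rfl htri, Finset.prod_mul_distrib] at hfan
  -- the exponentials multiply to `e^{-iS}`
  have hexp : (∏ j ∈ Finset.Ico 1 m, Complex.exp (-(I * (excess (q 0) (q j) (q (j + 1)) : ℂ))))
      = Complex.exp (-(I * ((∑ j ∈ Finset.Ico 1 m, excess (q 0) (q j) (q (j + 1)) : ℝ) : ℂ))) := by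
    rw [← Complex.exp_sum]; congr 1; push_cast; rw [Finset.mul_sum, ← Finset.sum_neg_distrib]
  rw [hexp] at hfan
  -- positivity of the real factors
  set P : ℝ := ∏ j ∈ Finset.Ico 2 m, ((q 0 ⨯₃ q j) ⬝ᵥ (q 0 ⨯₃ q j)) ^ 2 with hP
  set R : ℝ := ∏ j ∈ Finset.Ico 1 m, (((q (j + 1) ⨯₃ q 0) ⬝ᵥ (q (j + 1) ⨯₃ q 0))
      * ((q 0 ⨯₃ q j) ⬝ᵥ (q 0 ⨯₃ q j)) * ((q j ⨯₃ q (j + 1)) ⬝ᵥ (q j ⨯₃ q (j + 1)))) with hR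
  have hPc : (∏ j ∈ Finset.Ico 2 m, ((((q 0 ⨯₃ q j) ⬝ᵥ (q 0 ⨯₃ q j)) : ℝ) : ℂ) ^ 2) = (P : ℂ) := by
    rw [hP]; push_cast; rfl
  have hRc : (∏ j ∈ Finset.Ico 1 m, (((((q (j + 1) ⨯₃ q 0) ⬝ᵥ (q (j + 1) ⨯₃ q 0))
      * ((q 0 ⨯₃ q j) ⬝ᵥ (q 0 ⨯₃ q j)) * ((q j ⨯₃ q (j + 1)) ⬝ᵥ (q j ⨯₃ q (j + 1)))) : ℝ) : ℂ))
      = (R : ℂ) := by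
    rw [hR]; push_cast; rfl
  rw [hPc, hRc] at hfan
  have hRpos : 0 < R := by
    rw [hR]
    apply Finset.prod_pos
    intro j hj
    rw [Finset.mem_Ico] at hj
    have h := hτ j hj.1 hj.2
    have h1 : 0 < q j ⬝ᵥ (q (j + 1) ⨯₃ q 0) := by rwa [triple_product_cyclic]
    have h2 : 0 < q (j + 1) ⬝ᵥ (q 0 ⨯₃ q j) := by rw [triple_product_cyclic, triple_product_cyclic]; exact h
    exact mul_pos (mul_pos (real_dot_self_pos (cross_bc_ne_zero_of_triple_pos h1))
      (real_dot_self_pos (cross_bc_ne_zero_of_triple_pos h2)))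
      (real_dot_self_pos (cross_bc_ne_zero_of_triple_pos h))
  set S : ℝ := ∑ j ∈ Finset.Ico 1 m, excess (q 0) (q j) (q (j + 1)) with hS
  -- conjugate the fan identity
  have hconj := congrArg (starRingEnd ℂ) hfan
  rw [map_mul, hreal, Complex.conj_ofReal, map_mul, Complex.conj_ofReal, ← Complex.exp_conj,
    map_neg, map_mul, Complex.conj_I, Complex.conj_ofReal] at hconj
  -- compare the two expressions of `polyProd * P`
  have hcomp : (R : ℂ) * Complex.exp (-(I * (S : ℂ))) = (R : ℂ) * Complex.exp (-(-I * (S : ℂ))) :=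
    hfan.symm.trans hconj
  have hR0 : (R : ℂ) ≠ 0 := by exact_mod_cast hRpos.ne'
  have hexpeq := mul_left_cancel₀ hR0 hcomp
  have him := congrArg Complex.im hexpeq
  rw [show -(I * (S : ℂ)) = ((-S : ℝ) : ℂ) * I by push_cast; ring,
    show -(-I * (S : ℂ)) = ((S : ℝ) : ℂ) * I by ring,
    Complex.exp_ofReal_mul_I_im, Complex.exp_ofReal_mul_I_im, Real.sin_neg] at him
  linarith

end Fan

end KY

end Literature.Analysis.FluidPDE
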